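import Literature.Geometry.GeometricMeasureTheory.MassFormula

/-!
# The variation `‖T‖(U)` of a current on open sets

Federer 4.1.5/4.1.7: for a current `T` representable by integration, "`‖T‖(U) = sup {T(φ) :
spt φ ⊆ U, 𝐌(φ) ≤ 1}`" for open `U`, the **variation measure** evaluated on open sets. We define
this set function for the currents of `Literature.Geometry.GeometricMeasureTheory.Currents`,

* `Current.variationOn T U = ⨆ {ofReal (T φ) : ‖φ‖ ≤ 1 pointwise, tsupport φ ⊆ U}`,

prove its elementary properties (`variationOn_mono`, `variationOn_empty`, `variationOn_univ :
‖T‖(E) = 𝐌(T)`, `ofReal_apply_le_variationOn`), and identify it for currents representable by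
integration and for currents of integration:

* `variationOn_vectorCurrent_le`, `variationOn_vectorCurrent_eq` — **`‖μ ∧ F‖(U) = ∫_U ‖F‖ dμ`**
  for open `U ⊆ Ω` and `F` locally `μ`-integrable on `Ω` ("‖μ ∧ η‖ = μ ⌞ ‖η‖", 4.1.5), by the core
  estimate `exists_testForm_integral_ge` of `MassFormula.lean` localised inside `U` and a compact
  exhaustion of `U`;
* `IsRectifiableData.variationOn_eq` — **`‖[W, θ, ξ]‖(U) = ∫_{W ∩ U} |θ| d𝓗^m`** (Federer
  4.1.28 (5): "‖T‖ = 𝓗^m ⌞ Θ^m(‖T‖, ·)" with density `|θ|`), on open sets.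

The extension of `U ↦ ‖T‖(U)` to a Borel measure (a metric outer measure) is not done here.

Source: H. Federer, *Geometric Measure Theory*, Springer 1969 (`Federer1969`), 4.1.5, 4.1.7,
4.1.28 (5) (held copy `lit book:federernd-geometric-measure-theory`, PDF pp. 296–301, 325–326).
-/

noncomputable section

open scoped Distributions ENNReal NNReal Topology
open MeasureTheory TopologicalSpace Set Filter Metric

namespace Literature.Geometry.GeometricMeasureTheory

set_option maxSynthPendingDepth 3

/-! ### Definition and elementary properties -/

section Def

variable {E : Type*} [NormedAddCommGroup E] [NormedSpace ℝ E] {Ω : Opens E} {m : ℕ}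

/-- **The variation of a current on a set `U`**: "`‖T‖(U) = sup {T(φ) : φ ∈ 𝒟^m(U), 𝐌(φ) ≤ 1}`",
the supremum of `T(φ)` over test forms of pointwise comass `≤ 1` supported in `U` (for open `U`
this is the variation measure of `T` on `U`; for `U = E` it is the mass `𝐌(T)`).
[cite: Federer1969, 4.1.5 and 4.1.7] -/
def Current.variationOn (T : Current Ω m) (U : Set E) : ℝ≥0∞ :=
  ⨆ (φ : TestForm Ω m) (_ : ∀ x, ‖φ x‖ ≤ 1) (_ : tsupport ⇑φ ⊆ U), ENNReal.ofReal (T φ)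

/-- `T(φ) ≤ ‖T‖(U)` for `φ` of comass `≤ 1` supported in `U`. [cite: Federer1969, 4.1.5] -/
theorem Current.ofReal_apply_le_variationOn (T : Current Ω m) {U : Set E} {φ : TestForm Ω m}
    (hφ : ∀ x, ‖φ x‖ ≤ 1) (hU : tsupport ⇑φ ⊆ U) : ENNReal.ofReal (T φ) ≤ T.variationOn U :=
  le_iSup_of_le φ (le_iSup_of_le hφ (le_iSup_of_le hU le_rfl))

/-- `‖T‖` is monotone in the set. [cite: Federer1969, 4.1.5] -/
theorem Current.variationOn_mono (T : Current Ω m) {U U' : Set E} (h : U ⊆ U') :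
    T.variationOn U ≤ T.variationOn U' :=
  iSup_le fun _ => iSup_le fun hφ => iSup_le fun hU => T.ofReal_apply_le_variationOn hφ (hU.trans h)

/-- `‖T‖(∅) = 0` (only `φ = 0` is supported in `∅`). [cite: Federer1969, 4.1.5] -/
@[simp] theorem Current.variationOn_empty (T : Current Ω m) : T.variationOn ∅ = 0 := by
  refine le_antisymm (iSup_le fun φ => iSup_le fun _ => iSup_le fun hU => ?_) bot_le
  have : φ = 0 := TestFunction.ext fun x => image_eq_zero_of_notMem_tsupport fun h => hU h
  rw [this, map_zero, ENNReal.ofReal_zero]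

/-- **`‖T‖(E) = 𝐌(T)`.** [cite: Federer1969, 4.1.7] -/
theorem Current.variationOn_univ (T : Current Ω m) : T.variationOn univ = T.mass := by
  refine le_antisymm (iSup_le fun φ => iSup_le fun hφ => iSup_le fun _ =>
    T.ofReal_apply_le_mass hφ) (iSup₂_le fun φ hφ => ?_)
  exact T.ofReal_apply_le_variationOn hφ (subset_univ _)

/-- `‖T‖(U) ≤ 𝐌(T)`. [cite: Federer1969, 4.1.7] -/
theorem Current.variationOn_le_mass (T : Current Ω m) (U : Set E) : T.variationOn U ≤ T.mass := by
  rw [← T.variationOn_univ]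
  exact T.variationOn_mono (subset_univ U)

/-- `‖0‖(U) = 0`. [folklore] -/
@[simp] theorem Current.variationOn_zero (U : Set E) : (0 : Current Ω m).variationOn U = 0 := by
  simp [Current.variationOn]

/-- `‖-T‖(U) = ‖T‖(U)`. [folklore] -/
theorem Current.variationOn_neg (T : Current Ω m) (U : Set E) : (-T).variationOn U = T.variationOn U := by
  have key : ∀ S : Current Ω m, (-S).variationOn U ≤ S.variationOn U := by
    intro S
    refine iSup_le fun φ => iSup_le fun hφ => iSup_le fun hU => ?_
    have h1 : (-S) φ = S (-φ) := by simp
    rw [h1]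
    exact S.ofReal_apply_le_variationOn (fun x => by simpa using hφ x)
      (by rw [show ⇑(-φ) = -⇑φ from rfl, tsupport_neg]; exact hU)
  refine le_antisymm (key T) ?_
  simpa using key (-T)

end Def

/-! ### The variation of `μ ∧ F` on open sets -/

section VectorCurrent

variable {E : Type*} [NormedAddCommGroup E] [NormedSpace ℝ E] [MeasurableSpace E]
  [OpensMeasurableSpace E] {Ω : Opens E} {m : ℕ}

/-- **`‖μ ∧ F‖(U) ≤ ∫_U ‖F‖ dμ`.** [cite: Federer1969, 4.1.5] -/
theorem variationOn_vectorCurrent_le (μ : Measure E) (F : E → Multivector E m) (U : Set E) :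
    (vectorCurrent μ F : Current Ω m).variationOn U ≤ ∫⁻ x in U, ‖F x‖ₑ ∂μ := by
  by_cases hF : LocallyIntegrableOn F (Ω : Set E) μ
  · refine iSup_le fun φ => iSup_le fun hφ => iSup_le fun hU => ?_
    rw [vectorCurrent_apply hF, ← setIntegral_eq_integral_of_forall_compl_eq_zero (s := U)
      (fun x hx => by rw [image_eq_zero_of_notMem_tsupport fun h => hx (hU h), map_zero])]
    refine (ENNReal.ofReal_le_ofReal (le_abs_self _)).trans ?_
    rw [← Real.norm_eq_abs, ofReal_norm]
    refine (enorm_integral_le_lintegral_enorm _).trans (lintegral_mono fun x => ?_)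
    rw [← ofReal_norm, ← ofReal_norm]
    apply ENNReal.ofReal_le_ofReal
    calc ‖F x (φ x)‖ ≤ ‖F x‖ * ‖φ x‖ := (F x).le_opNorm _
      _ ≤ ‖F x‖ * 1 := by gcongr; exact hφ x
      _ = ‖F x‖ := mul_one _
  · rw [vectorCurrent_of_not_locallyIntegrableOn hF, Current.variationOn_zero]
    exact bot_le

end VectorCurrent

section VectorCurrentFD

variable {V : Type*} [NormedAddCommGroup V] [InnerProductSpace ℝ V] [FiniteDimensional ℝ V]
  [MeasurableSpace V] [BorelSpace V] {Ω : Opens V} {m : ℕ}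

/-- **`∫_K ‖F‖ dμ ≤ ‖μ ∧ F‖(U)` for compact `K ⊆ U`, `U ⊆ Ω` open** (the core estimate of
`MassFormula.lean` localised inside `U`). [cite: Federer1969, 4.1.5] -/
theorem setLIntegral_enorm_le_variationOn_vectorCurrent {μ : Measure V} {F : V → Multivector V m}
    (hF : LocallyIntegrableOn F (Ω : Set V) μ) {U K : Set V} (hU : IsOpen U) (hUΩ : U ⊆ (Ω : Set V))
    (hK : IsCompact K) (hKU : K ⊆ U) :
    ∫⁻ x in K, ‖F x‖ₑ ∂μ ≤ (vectorCurrent μ F : Current Ω m).variationOn U := by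
  have hKm : MeasurableSet K := hK.isClosed.measurableSet
  obtain ⟨r, hr, hrU⟩ := hK.exists_cthickening_subset_open hU hKU
  have hK' : IsCompact (cthickening r K) := hK.cthickening
  have hU₀ : IsOpen (thickening r K) := isOpen_thickening
  have hKU₀ : K ⊆ thickening r K := self_subset_thickening hr K
  have hU₀K' : thickening r K ⊆ cthickening r K := thickening_subset_cthickening r K
  have hrΩ : cthickening r K ⊆ (Ω : Set V) := hrU.trans hUΩ
  have hFi : Integrable F (μ.restrict (cthickening r K)) := hF.integrableOn_compact_subset hrΩ hK'
  have hFa : AEStronglyMeasurable F (μ.restrict (cthickening r K)) := hFi.aestronglyMeasurable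
  have hG : StronglyMeasurable (hFa.mk F) := hFa.stronglyMeasurable_mk
  have hFG : F =ᵐ[μ.restrict (cthickening r K)] hFa.mk F := hFa.ae_eq_mk
  have hGi : Integrable (hFa.mk F) (μ.restrict (cthickening r K)) := hFi.congr hFG
  have hrestr : (μ.restrict (cthickening r K)).restrict K = μ.restrict K := by
    rw [Measure.restrict_restrict hKm, inter_eq_left.2 (hKU₀.trans hU₀K')]
  have hX : ∫⁻ x in K, ‖F x‖ₑ ∂μ = ∫⁻ x in K, ‖hFa.mk F x‖ₑ ∂(μ.restrict (cthickening r K)) := by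
    rw [hrestr]
    refine lintegral_congr_ae ?_
    have : F =ᵐ[μ.restrict K] hFa.mk F := by rw [← hrestr]; exact ae_restrict_of_ae hFG
    exact this.mono fun x hx => by simp only [hx]
  have hXtop : ∫⁻ x in K, ‖hFa.mk F x‖ₑ ∂(μ.restrict (cthickening r K)) ≠ ⊤ :=
    ((lintegral_mono' Measure.restrict_le_self le_rfl).trans_lt hGi.2).ne
  by_cases hvar : (vectorCurrent μ F : Current Ω m).variationOn U = ⊤
  · rw [hvar]; exact le_top
  have key : ∀ ε : ℝ, 0 < ε → ε < 1 →
      (1 - ε) * (∫⁻ x in K, ‖hFa.mk F x‖ₑ ∂(μ.restrict (cthickening r K))).toReal - 3 * ε ≤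
        ((vectorCurrent μ F : Current Ω m).variationOn U).toReal := by
    intro ε hε hε1
    obtain ⟨φ, hφ1, hφ0, hφge⟩ := exists_testForm_integral_ge (Ω := Ω)
      (μ.restrict (cthickening r K)) hG hGi hK hK' hU₀ hKU₀ hU₀K' hrΩ hε hε1
    have hs : Function.support ⇑φ ⊆ thickening r K := fun x hx => by
      by_contra h
      exact hx (hφ0 x h)
    have hsupp : tsupport ⇑φ ⊆ U :=
      (closure_mono hs).trans ((closure_thickening_subset_cthickening r K).trans hrU)
    have hT : vectorCurrent μ F φ = ∫ x, hFa.mk F x (φ x) ∂(μ.restrict (cthickening r K)) := by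
      rw [vectorCurrent_apply hF, ← setIntegral_eq_integral_of_forall_compl_eq_zero
        (s := cthickening r K) (fun x hx => by rw [hφ0 x fun h => hx (hU₀K' h), map_zero])]
      exact integral_congr_ae (hFG.mono fun x hx => by simp only [hx])
    have hle : ENNReal.ofReal (vectorCurrent μ F φ) ≤ (vectorCurrent μ F : Current Ω m).variationOn U :=
      Current.ofReal_apply_le_variationOn _ hφ1 hsupp
    have h1 : vectorCurrent μ F φ ≤ (ENNReal.ofReal (vectorCurrent μ F φ)).toReal := by
      rw [ENNReal.toReal_ofReal']
      exact le_max_left _ _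
    have h2 := ENNReal.toReal_mono hvar hle
    linarith
  have hlim : (∫⁻ x in K, ‖hFa.mk F x‖ₑ ∂(μ.restrict (cthickening r K))).toReal ≤
      ((vectorCurrent μ F : Current Ω m).variationOn U).toReal := by
    set X := (∫⁻ x in K, ‖hFa.mk F x‖ₑ ∂(μ.restrict (cthickening r K))).toReal
    have htend : Tendsto (fun ε : ℝ => (1 - ε) * X - 3 * ε) (𝓝[>] 0)
        (𝓝 ((1 - 0) * X - 3 * 0)) :=
      ((((continuous_const.sub continuous_id).mul continuous_const).sub
        (continuous_const.mul continuous_id)).tendsto 0).mono_left nhdsWithin_le_nhds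
    rw [sub_zero, one_mul, mul_zero, sub_zero] at htend
    refine le_of_tendsto htend ?_
    filter_upwards [Ioo_mem_nhdsGT one_pos] with ε hε
    exact key ε hε.1 hε.2
  rw [hX]
  exact (ENNReal.toReal_le_toReal hXtop hvar).1 hlim

/-- **`‖μ ∧ F‖(U) = ∫_U ‖F‖ dμ` for open `U ⊆ Ω`** ("‖μ ∧ η‖ = μ ⌞ ‖η‖").
[cite: Federer1969, 4.1.5] -/
theorem variationOn_vectorCurrent_eq {μ : Measure V} {F : V → Multivector V m}
    (hF : LocallyIntegrableOn F (Ω : Set V) μ) {U : Set V} (hU : IsOpen U) (hUΩ : U ⊆ (Ω : Set V)) :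
    (vectorCurrent μ F : Current Ω m).variationOn U = ∫⁻ x in U, ‖F x‖ₑ ∂μ := by
  refine le_antisymm (variationOn_vectorCurrent_le μ F U) ?_
  -- exhaust `U` by compacts
  obtain ⟨K, hKc, hKU, hKabs⟩ := exists_compact_exhaustion (⟨U, hU⟩ : Opens V)
  have hcov : U ⊆ ⋃ n, Set.accumulate K n := by
    rw [Set.iUnion_accumulate]
    intro x hx
    obtain ⟨n, hn⟩ := hKabs {x} isCompact_singleton (singleton_subset_iff.2 hx)
    exact mem_iUnion.2 ⟨n, hn rfl⟩
  have hsub : (⋃ n, Set.accumulate K n) ⊆ U :=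
    iUnion_subset fun n => iUnion₂_subset fun i _ => hKU i
  have hmono : Monotone fun n => Set.accumulate K n := Set.monotone_accumulate
  calc ∫⁻ x in U, ‖F x‖ₑ ∂μ = ∫⁻ x in ⋃ n, Set.accumulate K n, ‖F x‖ₑ ∂μ := by
        rw [Subset.antisymm hcov hsub]
    _ = ⨆ n, ∫⁻ x in Set.accumulate K n, ‖F x‖ₑ ∂μ :=
        setLIntegral_iUnion_of_directed _ hmono.directed_le
    _ ≤ (vectorCurrent μ F : Current Ω m).variationOn U := iSup_le fun n =>
        setLIntegral_enorm_le_variationOn_vectorCurrent hF hU hUΩ (isCompact_accumulate hKc n)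
          (iUnion₂_subset fun i _ => hKU i)

/-- **`‖[W, θ, ξ]‖(U) = ∫_{W ∩ U} |θ| d𝓗^m` for admissible data and open `U ⊆ Ω`** — the variation
measure of a current of integration is `|θ| 𝓗^m ⌞ W` (on open sets). [cite: Federer1969, 4.1.28 (5)] -/
theorem IsRectifiableData.variationOn_eq {W : Set V} {θ : V → ℤ} {ξ : V → Fin m → V}
    (h : IsRectifiableData Ω m W θ ξ) {U : Set V} (hU : IsOpen U) (hUΩ : U ⊆ (Ω : Set V)) :
    (currentOfIntegration W θ ξ : Current Ω m).variationOn U =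
      ∫⁻ x in W ∩ U, ‖(θ x : ℝ)‖ₑ ∂(μHE[m] : Measure V) := by
  rw [currentOfIntegration, variationOn_vectorCurrent_eq h.2.2.2.1 hU hUΩ,
    Measure.restrict_restrict hU.measurableSet, inter_comm]
  refine lintegral_congr_ae ?_
  have hae : ∀ᵐ x ∂(μHE[m] : Measure V).restrict (W ∩ U), Orthonormal ℝ (ξ x) := by
    filter_upwards [ae_mono (Measure.restrict_mono inter_subset_left le_rfl) h.2.2.2.2] with x hx
    exact hx.1
  filter_upwards [hae] with x hx
  rw [enorm_smul, ← ofReal_norm (frameVector (ξ x)), norm_frameVector_eq_one hx,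
    ENNReal.ofReal_one, mul_one]

end VectorCurrentFD

end Literature.Geometry.GeometricMeasureTheory
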